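import Summits.QuantumAdvantage.QuantumAdvantage.Theorems.OddPrimeWalkFourBlindBitsIdentities

/-!
# OddPrimeWalk — FOUR BLIND BITS ⇒ INNER SEGMENT NULL (item 24253, planner qa-qnc0-p2 g32, ROUND-32 §2.3)

Cell qa-qnc0, route OddPrimeWalk; support for the register-rigidity crux (R₁) `SingleClassRegisterRigidityFive`
(stmt-QuantumAdvantage-24200).  Prover qn-prover-3 g19.

THEOREM `oddPrimeWalk_fourBlindBitsInnerNull` (the planner's typed signature): `y` ignores the bits `p₁ < p₂ < p₃ < p₄`, `u`
vanishes there, and the win bit is CONSTANT over the completions `u^S`, `S ⊆ {p₁..p₄}`, of one weight class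
`|u| + |S| ≡ b (mod 3)`; then the cuts fired at `u` in the inner segment `(p₂, p₃]` have label counts
`N_e = #{g : p₂ < g ≤ p₃, (g + W_g(u)) ≡ e}` with `N_0 ≡ N_1 ≡ N_2 (mod 2)`.

PROOF.  The constancy hypothesis, read through `card_win_fillS` (`OddPrimeWalkThreeBlindBits`), says the win counts
`cardWinFill c y u S` of two completions in the class have the same parity; feeding the pairs of the class into the six
pointwise identities of `OddPrimeWalkFourBlindBitsIdentities` (`ident2a/2b` for size `2`, `ident1a/1b` for sizes `1, 4`,
`ident0a/0b` for sizes `0, 3`) gives `K₀ ≡ K₁ ≡ K₂ (mod 2)` for the shifted inner counts `segK`, and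
`N_e = K_{(3 − (c + |u| + e) % 3) % 3}`.
WHAT THIS IS NOT: (R₁) itself (item 24200) is NOT proved; no separation moved.
-/

namespace Summit.QuantumAdvantage.QuantumAdvantage.Theorems

open Finset Summit.QuantumAdvantage.AdviceFreeQNC0 Summit.QuantumAdvantage.AdviceFreeQNC0.OddConfig

set_option linter.dupNamespace false in
/-- **FOUR BLIND BITS ⇒ INNER SEGMENT NULL** (item 24253, planner qa-qnc0-p2 g32 ROUND-32 §2.3, typed verbatim). -/
theorem oddPrimeWalk_fourBlindBitsInnerNull :
    ∀ (n c : ℕ) (y : Fin (n + 1) → (Fin n → Bool) → Bool) (i₁ i₂ i₃ i₄ : Fin n), i₁ < i₂ → i₂ < i₃ →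
    i₃ < i₄ → (∀ g u b, y g (Function.update u i₁ b) = y g u) → (∀ g u b, y g (Function.update u i₂
    b) = y g u) → (∀ g u b, y g (Function.update u i₃ b) = y g u) → (∀ g u b, y g (Function.update u
    i₄ b) = y g u) → ∀ u : Fin n → Bool, u i₁ = false → u i₂ = false → u i₃ = false → u i₄ = false →
    ∀ b : ℕ, b < 3 → (∀ S S' : Finset (Fin n), S ⊆ {i₁, i₂, i₃, i₄} → S' ⊆ {i₁, i₂, i₃, i₄} →
    (Summit.QuantumAdvantage.AdviceFreeQNC0.wt u + S.card) % 3 = b →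
    (Summit.QuantumAdvantage.AdviceFreeQNC0.wt u + S'.card) % 3 = b →
    Summit.QuantumAdvantage.AdviceFreeQNC0.ringWinU c y (fun i => u i || decide (i ∈ S)) =
    Summit.QuantumAdvantage.AdviceFreeQNC0.ringWinU c y (fun i => u i || decide (i ∈ S'))) → ∀ e <
    3, ∀ e' < 3, (Finset.univ.filter fun g : Fin (n + 1) => y g u = true ∧ i₂.val < g.val ∧ g.val ≤
    i₃.val ∧ (g.val + Summit.QuantumAdvantage.AdviceFreeQNC0.wtPrefix u g.val) % 3 = e).card % 2 =
    (Finset.univ.filter fun g : Fin (n + 1) => y g u = true ∧ i₂.val < g.val ∧ g.val ≤ i₃.val ∧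
    (g.val + Summit.QuantumAdvantage.AdviceFreeQNC0.wtPrefix u g.val) % 3 = e').card % 2 := by
  intro n c y p₁ p₂ p₃ p₄ h12 h23 h34 hB1 hB2 hB3 hB4 u hu1 hu2 hu3 hu4 b hb hconst e he e' he'
  have l12 : p₁.val < p₂.val := h12
  have l23 : p₂.val < p₃.val := h23
  have l34 : p₃.val < p₄.val := h34
  have n12 : p₁ ≠ p₂ := fun h => by subst h; omega
  have n13 : p₁ ≠ p₃ := fun h => by subst h; omega
  have n14 : p₁ ≠ p₄ := fun h => by subst h; omega
  have n23 : p₂ ≠ p₃ := fun h => by subst h; omega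
  have n24 : p₂ ≠ p₄ := fun h => by subst h; omega
  have n34 : p₃ ≠ p₄ := fun h => by subst h; omega
  -- blindness and vanishing on the subsets of `Q = {p₁, p₂, p₃, p₄}`
  have hbl : ∀ S : Finset (Fin n), S ⊆ {p₁, p₂, p₃, p₄} → ∀ g, y g (fillS u S) = y g u := by
    intro S hS g
    refine apply_fillS_of_blind y S (fun s hs => ?_) g u
    have hs' := hS hs
    simp only [mem_insert, mem_singleton] at hs'
    rcases hs' with rfl | rfl | rfl | rfl
    exacts [hB1, hB2, hB3, hB4]
  have hz : ∀ S : Finset (Fin n), S ⊆ {p₁, p₂, p₃, p₄} → ∀ s ∈ S, u s = false := by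
    intro S hS s hs
    have hs' := hS hs
    simp only [mem_insert, mem_singleton] at hs'
    rcases hs' with rfl | rfl | rfl | rfl
    exacts [hu1, hu2, hu3, hu4]
  -- the constancy hypothesis as an equality of win-count parities
  have hP : ∀ S S' : Finset (Fin n), S ⊆ {p₁, p₂, p₃, p₄} → S' ⊆ {p₁, p₂, p₃, p₄} →
      (wt u + S.card) % 3 = b → (wt u + S'.card) % 3 = b →
      cardWinFill c y u S % 2 = cardWinFill c y u S' % 2 := by
    intro S S' hS hS' h1 h2
    have h := hconst S S' hS hS' h1 h2
    have e1 := card_win_fillS c y u S (hz S hS) (hbl S hS)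
    have e2 := card_win_fillS c y u S' (hz S' hS') (hbl S' hS')
    change ringWinU c y (fillS u S) = ringWinU c y (fillS u S') at h
    rw [h] at e1
    have e3 := e1.symm.trans e2
    by_cases hc : cardWinFill c y u S % 2 = 1
    · have := e3.mp hc
      omega
    · have : ¬ cardWinFill c y u S' % 2 = 1 := fun h' => hc (e3.mpr h')
      omega
  -- the fourteen sets used
  have sub : ∀ S : Finset (Fin n), (∀ s ∈ S, s = p₁ ∨ s = p₂ ∨ s = p₃ ∨ s = p₄) → S ⊆ {p₁, p₂, p₃, p₄} := by
    intro S h s hs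
    simp only [mem_insert, mem_singleton]
    exact h s hs
  have mem1 : ∀ s : Fin n, s ∈ ({p₁} : Finset (Fin n)) → s = p₁ ∨ s = p₂ ∨ s = p₃ ∨ s = p₄ := by
    intro s hs; rw [mem_singleton] at hs; tauto
  have mem2 : ∀ s : Fin n, s ∈ ({p₂} : Finset (Fin n)) → s = p₁ ∨ s = p₂ ∨ s = p₃ ∨ s = p₄ := by
    intro s hs; rw [mem_singleton] at hs; tauto
  have mem3 : ∀ s : Fin n, s ∈ ({p₃} : Finset (Fin n)) → s = p₁ ∨ s = p₂ ∨ s = p₃ ∨ s = p₄ := by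
    intro s hs; rw [mem_singleton] at hs; tauto
  have mem4 : ∀ s : Fin n, s ∈ ({p₄} : Finset (Fin n)) → s = p₁ ∨ s = p₂ ∨ s = p₃ ∨ s = p₄ := by
    intro s hs; rw [mem_singleton] at hs; tauto
  have memI : ∀ (a : Fin n) (T : Finset (Fin n)), (a = p₁ ∨ a = p₂ ∨ a = p₃ ∨ a = p₄) →
      (∀ s ∈ T, s = p₁ ∨ s = p₂ ∨ s = p₃ ∨ s = p₄) →
      ∀ s ∈ insert a T, s = p₁ ∨ s = p₂ ∨ s = p₃ ∨ s = p₄ := by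
    intro a T ha hT s hs
    rw [mem_insert] at hs
    rcases hs with rfl | hs
    · exact ha
    · exact hT s hs
  have q1 : (p₁ = p₁ ∨ p₁ = p₂ ∨ p₁ = p₃ ∨ p₁ = p₄) := Or.inl rfl
  have q2 : (p₂ = p₁ ∨ p₂ = p₂ ∨ p₂ = p₃ ∨ p₂ = p₄) := Or.inr (Or.inl rfl)
  have q3 : (p₃ = p₁ ∨ p₃ = p₂ ∨ p₃ = p₃ ∨ p₃ = p₄) := Or.inr (Or.inr (Or.inl rfl))
  have q4 : (p₄ = p₁ ∨ p₄ = p₂ ∨ p₄ = p₃ ∨ p₄ = p₄) := Or.inr (Or.inr (Or.inr rfl))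
  have s0 : (∅ : Finset (Fin n)) ⊆ {p₁, p₂, p₃, p₄} := empty_subset _
  have s1 := sub _ mem1
  have s2 := sub _ mem2
  have s3 := sub _ mem3
  have s4 := sub _ mem4
  have s12 := sub _ (memI p₁ _ q1 mem2)
  have s13 := sub _ (memI p₁ _ q1 mem3)
  have s24 := sub _ (memI p₂ _ q2 mem4)
  have s34 := sub _ (memI p₃ _ q3 mem4)
  have s124 := sub _ (memI p₁ _ q1 (memI p₂ _ q2 mem4))
  have s134 := sub _ (memI p₁ _ q1 (memI p₃ _ q3 mem4))
  have s234 := sub _ (memI p₂ _ q2 (memI p₃ _ q3 mem4))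
  have s123 := sub _ (memI p₁ _ q1 (memI p₂ _ q2 mem3))
  have s1234 := sub _ (memI p₁ _ q1 (memI p₂ _ q2 (memI p₃ _ q3 mem4)))
  -- their sizes
  have m1_23 : p₁ ∉ ({p₂, p₃} : Finset (Fin n)) := by simp [n12, n13]
  have m1_24 : p₁ ∉ ({p₂, p₄} : Finset (Fin n)) := by simp [n12, n14]
  have m1_34 : p₁ ∉ ({p₃, p₄} : Finset (Fin n)) := by simp [n13, n14]
  have m2_34 : p₂ ∉ ({p₃, p₄} : Finset (Fin n)) := by simp [n23, n24]
  have m1_234 : p₁ ∉ ({p₂, p₃, p₄} : Finset (Fin n)) := by simp [n12, n13, n14]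
  have c12 : ({p₁, p₂} : Finset (Fin n)).card = 2 := card_pair n12
  have c13 : ({p₁, p₃} : Finset (Fin n)).card = 2 := card_pair n13
  have c24 : ({p₂, p₄} : Finset (Fin n)).card = 2 := card_pair n24
  have c34 : ({p₃, p₄} : Finset (Fin n)).card = 2 := card_pair n34
  have c124 : ({p₁, p₂, p₄} : Finset (Fin n)).card = 3 := by rw [card_insert_of_notMem m1_24, card_pair n24]
  have c134 : ({p₁, p₃, p₄} : Finset (Fin n)).card = 3 := by rw [card_insert_of_notMem m1_34, card_pair n34]
  have c234 : ({p₂, p₃, p₄} : Finset (Fin n)).card = 3 := by rw [card_insert_of_notMem m2_34, card_pair n34]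
  have c123 : ({p₁, p₂, p₃} : Finset (Fin n)).card = 3 := by rw [card_insert_of_notMem m1_23, card_pair n23]
  have c1234 : ({p₁, p₂, p₃, p₄} : Finset (Fin n)).card = 4 := by
    rw [card_insert_of_notMem m1_234, card_insert_of_notMem m2_34, card_pair n34]
  -- `K₀ ≡ K₁ ≡ K₂ (mod 2)` in each of the three weight classes
  have hK : segK c y u p₂ p₃ 0 % 2 = segK c y u p₂ p₃ 1 % 2 ∧ segK c y u p₂ p₃ 1 % 2 = segK c y u p₂ p₃ 2 % 2 := by
    rcases (by omega : (wt u + 2) % 3 = b ∨ (wt u + 1) % 3 = b ∨ (wt u + 0) % 3 = b) with hr | hr | hr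
    · have w1 := hP _ _ s12 s13 (by rw [c12]; exact hr) (by rw [c13]; exact hr)
      have w2 := hP _ _ s24 s34 (by rw [c24]; exact hr) (by rw [c34]; exact hr)
      have i1 := ident2a c y u p₁ p₂ p₃ p₄ h12 h23 h34
      have i2 := ident2b c y u p₁ p₂ p₃ p₄ h12 h23 h34
      omega
    · have w1 := hP _ _ s2 s3 (by rw [card_singleton]; exact hr) (by rw [card_singleton]; exact hr)
      have w2 := hP _ _ s1 s2 (by rw [card_singleton]; exact hr) (by rw [card_singleton]; exact hr)
      have w3 := hP _ _ s4 s1234 (by rw [card_singleton]; exact hr) (by rw [c1234]; omega)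
      have i1 := ident1a c y u p₁ p₂ p₃ p₄ h12 h23 h34
      have i2 := ident1b c y u p₁ p₂ p₃ p₄ h12 h23 h34
      omega
    · have w1 := hP _ _ s124 s134 (by rw [c124]; omega) (by rw [c134]; omega)
      have w2 := hP _ _ s0 s234 (by rw [card_empty]; exact hr) (by rw [c234]; omega)
      have w3 := hP _ _ s123 s124 (by rw [c123]; omega) (by rw [c124]; omega)
      have i1 := ident0a c y u p₁ p₂ p₃ p₄ h12 h23 h34
      have i2 := ident0b c y u p₁ p₂ p₃ p₄ h12 h23 h34
      omega
  -- label counts are shifted `segK`s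
  have hL : ∀ e₀ : ℕ, e₀ < 3 →
      (Finset.univ.filter fun g : Fin (n + 1) => y g u = true ∧ p₂.val < g.val ∧ g.val ≤ p₃.val ∧
          (g.val + wtPrefix u g.val) % 3 = e₀).card = segK c y u p₂ p₃ ((3 - (c + wt u + e₀) % 3) % 3) := by
    intro e₀ he₀
    unfold segK
    refine congrArg Finset.card (filter_congr fun g _ => ?_)
    constructor
    · rintro ⟨h1, h2, h3, h4⟩
      exact ⟨h1, ⟨h2, h3⟩, by omega⟩
    · rintro ⟨h1, ⟨h2, h3⟩, h4⟩
      exact ⟨h1, h2, h3, by omega⟩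
  obtain ⟨hK1, hK2⟩ := hK
  have hT : ∀ t : ℕ, t < 3 → segK c y u p₂ p₃ t % 2 = segK c y u p₂ p₃ 0 % 2 := by
    intro t ht
    interval_cases t
    · rfl
    · omega
    · omega
  rw [hL e he, hL e' he', hT _ (Nat.mod_lt _ (by norm_num)), hT _ (Nat.mod_lt _ (by norm_num))]

end Summit.QuantumAdvantage.QuantumAdvantage.Theorems
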